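import Mathlib
import Literature.RingTheory.MvPowerSeries.LeadingFormSubst
import Literature.RingTheory.MvPowerSeries.SeparatedVariablesProduct
import HarnessLib

/-!
# The Liouville lower bound for separated-variables auxiliary functions (CDT §2.2, (2.6))

`Literature/RingTheory/MvPowerSeries/LowestOrderIntegrality.lean`. Everything here is PROVED (no
definition, no named fact). In the extrapolation step of F. Calegari, V. Dimitrov, Y. Tang,
*The unbounded denominators conjecture* (J. Amer. Math. Soc. **38** (2025), 627–702;
arXiv:2109.09040), §2.2 (proof of Lemma 2.0.4), the auxiliary function of Lemma 2.1.1 has the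
separated-variables shape (2.5)

  `F(x) = ∑_J a_J ∏_{s=1}^d g_{J,s}(x_s) ∈ ℚ⟦x₁, …, x_d⟧`,  `a_J ∈ ℤ`,

where every one-variable constituent `g_{J,s} = p^{k_s} f_{i_s} ∈ ℚ⟦x⟧` becomes integral after the
substitution `x = x(t) ∈ t + t²ℚ⟦t⟧`: `g_{J,s}(x(t)) ∈ ℤ⟦t⟧`. The printed argument reads: "Let
`β ≥ α` be the exact order of vanishing of `F(x) ∈ ℚ⟦x⟧ ∖ {0}` at `x = 0`, and consider `c xⁿ` any
nonzero monomial of that lowest order `β = |n|`. Since `x(t) ∈ t + t²ℚ⟦t⟧`, the term `c tⁿ` is a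
lowest order monomial in the formal power series `F(x(t)) ∈ ℤ⟦t⟧`, and so `c ∈ ℤ ∖ {0}`. Thus we
have the Liouville lower bound: `|c| ≥ 1`." We formalize exactly this:

* `subst_toMvPowerSeries_diag` / `subst_sum_smul_prod_toMvPowerSeries` — the diagonal
  substitution `x_s ↦ x(t_s)` (Mathlib's `MvPowerSeries.subst`) acts factorwise on (2.5):
  `F(x(t)) = ∑_J a_J ∏_s (g_{J,s} ∘ x)(t_s)`;
* `coeff_subst_diag_of_degree_le_order` — for `x ∈ t + t²K⟦t⟧`, the coefficients of `F(x(t))`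
  and of `F` agree in degree `β ≤ ord F` (from `coeff_subst_of_degree_eq` of
  `LeadingFormSubst.lean` with all `λ_s = 1`);
* `coeff_eq_map_of_degree_le_order` — hence, if all `g_{J,s} ∘ x` have coefficients in a subring
  `A → K` and `a_J ∈ A`, every coefficient of `F` of degree `β ≤ ord F` lies in `A`, with the
  explicit witness `∑_J a_J ∏_s [t^{n_s}](g_{J,s} ∘ x)`;
* `exists_coeff_eq_intCast_of_ne_zero` / `one_le_abs_coeff_of_ne_zero` — the Liouville lower
  bound proper over `ℚ`: a nonzero such `F` has a lowest-order coefficient `c ∈ ℤ ∖ {0}`,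
  `|c| ≥ 1`.

## References

* [CalegariDimitrovTang2025] F. Calegari, V. Dimitrov, Y. Tang, The unbounded denominators
  conjecture, J. Amer. Math. Soc. 38 (2025), no. 3, 627–702, §2.2, display (2.6);
  arXiv:2109.09040.
-/

noncomputable section

open Finset MvPowerSeries Finsupp

namespace Literature.RingTheory.MvPowerSeries

variable {σ : Type*} [Fintype σ] [DecidableEq σ] {K : Type*} [CommRing K]

/-! ### 1. The diagonal substitution `x_s ↦ x(t_s)` -/

omit [Fintype σ] in
/-- The linear part of `x(t_s)` for `x ∈ t + t²K⟦t⟧` (more generally `[t¹] x = 1`) is `x_s`.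
[folklore] -/
theorem homogeneousComponent_one_toMvPowerSeries {x : PowerSeries K}
    (hx1 : PowerSeries.coeff 1 x = 1) (s : σ) :
    homogeneousComponent 1 (x.toMvPowerSeries s : MvPowerSeries σ K) = (1 : K) • X s := by
  ext d
  rw [coeff_homogeneousComponent, one_smul, coeff_X, coeff_toMvPowerSeries]
  by_cases hd : d.degree = 1
  · rw [if_pos hd]
    by_cases hds : d = single s (d s)
    · have h1 : d s = 1 := by
        have h := hd
        rw [hds, degree_single] at h
        exact h
      rw [if_pos hds, h1, hx1, if_pos (by rw [← h1]; exact hds)]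
    · rw [if_neg hds, if_neg]
      intro h
      apply hds
      rw [h, single_eq_same]
  · rw [if_neg hd, if_neg]
    intro h
    apply hd
    rw [h, degree_single]

omit [Fintype σ] [DecidableEq σ] in
/-- **The diagonal substitution acts factorwise**: substituting `x_{s'} ↦ x(t_{s'})` (all `s'`)
into the one-variable factor `g(x_s)` gives `(g ∘ x)(t_s)`. [folklore] -/
theorem subst_toMvPowerSeries_diag (g : PowerSeries K) {x : PowerSeries K}
    (hx0 : PowerSeries.constantCoeff x = 0) (s : σ) :
    MvPowerSeries.subst (fun s' : σ ↦ (x.toMvPowerSeries s' : MvPowerSeries σ K))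
        (g.toMvPowerSeries s : MvPowerSeries σ K) =
      PowerSeries.toMvPowerSeries s (PowerSeries.subst x g : PowerSeries K) := by
  rw [PowerSeries.subst_toMvPowerSeries (HasSubst.toMvPowerSeries hx0),
    PowerSeries.toMvPowerSeries_eq_subst, PowerSeries.toMvPowerSeries_eq_subst,
    PowerSeries.subst_comp_subst_apply (PowerSeries.HasSubst.of_constantCoeff_zero' hx0)
      (PowerSeries.HasSubst.X s)]

omit [DecidableEq σ] in
/-- **`F(x(t))` for `F` of the separated shape (2.5)**:
`(∑_J a_J ∏_s g_{J,s}(x_s))(x(t)) = ∑_J a_J ∏_s (g_{J,s} ∘ x)(t_s)`.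
[cite: CalegariDimitrovTang2025, §2.2, before (2.6)] -/
theorem subst_sum_smul_prod_toMvPowerSeries {ι : Type*} (J : Finset ι) (c : ι → K)
    (g : ι → σ → PowerSeries K) {x : PowerSeries K} (hx0 : PowerSeries.constantCoeff x = 0) :
    MvPowerSeries.subst (fun s' : σ ↦ (x.toMvPowerSeries s' : MvPowerSeries σ K))
        (∑ j ∈ J, c j • ∏ s, ((g j s).toMvPowerSeries s : MvPowerSeries σ K)) =
      ∑ j ∈ J, c j • ∏ s, (PowerSeries.toMvPowerSeries s (PowerSeries.subst x (g j s) :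
        PowerSeries K) : MvPowerSeries σ K) := by
  -- the diagonal substitution `x_s ↦ x(t_s)` (`x(0) = 0`) is admissible: Mathlib's
  -- `MvPowerSeries.HasSubst.toMvPowerSeries`
  have ha : HasSubst (fun s' : σ ↦ (x.toMvPowerSeries s' : MvPowerSeries σ K)) :=
    HasSubst.toMvPowerSeries hx0
  rw [← coe_substAlgHom ha, map_sum]
  refine sum_congr rfl fun j _ ↦ ?_
  rw [map_smul, map_prod]
  refine congrArg (c j • ·) (prod_congr rfl fun s _ ↦ ?_)
  rw [coe_substAlgHom, subst_toMvPowerSeries_diag (g j s) hx0 s]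

/-! ### 2. Lowest-order coefficients are unchanged, hence integral -/

/-- **Lowest-order coefficients survive `x ↦ x(t)`**: for `x ∈ t + t²K⟦t⟧` (i.e. `x(0) = 0`,
`[t¹]x = 1`) and `F` of order `≥ β`, `[tᵉ] F(x(t)) = [xᵉ] F` for every `e` of degree `β`.
[cite: CalegariDimitrovTang2025, §2.2, (2.6)] -/
theorem coeff_subst_diag_of_degree_le_order {x : PowerSeries K}
    (hx0 : PowerSeries.constantCoeff x = 0) (hx1 : PowerSeries.coeff 1 x = 1)
    (F : MvPowerSeries σ K) {β : ℕ} (hF : (β : ℕ∞) ≤ F.order) {e : σ →₀ ℕ} (he : e.degree = β) :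
    coeff e (MvPowerSeries.subst (fun s' : σ ↦ (x.toMvPowerSeries s' : MvPowerSeries σ K)) F) =
      coeff e F := by
  have ha0 : ∀ s : σ, constantCoeff ((x.toMvPowerSeries s : MvPowerSeries σ K)) = 0 := by
    intro s
    rw [← coeff_zero_eq_constantCoeff_apply, coeff_toMvPowerSeries]
    simp [hx0]
  rw [coeff_subst_of_degree_eq (lam := fun _ ↦ (1 : K)) ha0
    (fun s ↦ homogeneousComponent_one_toMvPowerSeries hx1 s) F hF he]
  simp

/-- **Integrality of the lowest-order coefficients** (CDT's "`c ∈ ℤ`"): let `A → K` be a ring map,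
`F = ∑_{J} a_J ∏_s g_{J,s}(x_s)` with `a_J ∈ A`, and suppose every `g_{J,s} ∘ x` is the image of
a series `G_{J,s} ∈ A⟦t⟧`, where `x ∈ t + t²K⟦t⟧`. Then for every `e` of degree `β ≤ ord F`,
`[xᵉ] F` is the image of `∑_J a_J ∏_s [t^{e_s}] G_{J,s} ∈ A`.
[cite: CalegariDimitrovTang2025, §2.2, (2.6)] -/
theorem coeff_eq_map_of_degree_le_order {A : Type*} [CommRing A] (φ : A →+* K) {ι : Type*}
    (J : Finset ι) (a : ι → A) (g : ι → σ → PowerSeries K) (G : ι → σ → PowerSeries A)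
    {x : PowerSeries K} (hx0 : PowerSeries.constantCoeff x = 0) (hx1 : PowerSeries.coeff 1 x = 1)
    (hG : ∀ j ∈ J, ∀ s, (G j s).map φ = PowerSeries.subst x (g j s)) {β : ℕ}
    (hF : (β : ℕ∞) ≤
      (∑ j ∈ J, φ (a j) • ∏ s, ((g j s).toMvPowerSeries s : MvPowerSeries σ K)).order)
    {e : σ →₀ ℕ} (he : e.degree = β) :
    coeff e (∑ j ∈ J, φ (a j) • ∏ s, ((g j s).toMvPowerSeries s : MvPowerSeries σ K)) =
      φ (∑ j ∈ J, a j * ∏ s, PowerSeries.coeff (e s) (G j s)) := by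
  rw [← coeff_subst_diag_of_degree_le_order hx0 hx1 _ hF he,
    subst_sum_smul_prod_toMvPowerSeries J _ g hx0, coeff_sum_smul_prod_toMvPowerSeries, map_sum]
  refine sum_congr rfl fun j hj ↦ ?_
  rw [map_mul, map_prod]
  refine congrArg (φ (a j) * ·) (prod_congr rfl fun s _ ↦ ?_)
  rw [← hG j hj s, PowerSeries.coeff_map]

/-! ### 3. The Liouville lower bound over `ℚ` -/

/-- **The Liouville lower bound, existence form** (CDT §2.2, (2.6)): for a *nonzero*
`F = ∑_J a_J ∏_s g_{J,s}(x_s) ∈ ℚ⟦x⟧` with `a_J ∈ ℤ` and all `g_{J,s}(x(t)) ∈ ℤ⟦t⟧`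
(`x ∈ t + t²ℚ⟦t⟧`), there is a lowest-order multi-index `n` (`|n| = ord F`, all coefficients of
smaller degree vanish) whose coefficient is a nonzero integer `c`.
[cite: CalegariDimitrovTang2025, §2.2, (2.6)] -/
theorem exists_coeff_eq_intCast_of_ne_zero {ι : Type*} (J : Finset ι) (a : ι → ℤ)
    (g : ι → σ → PowerSeries ℚ) (G : ι → σ → PowerSeries ℤ) {x : PowerSeries ℚ}
    (hx0 : PowerSeries.constantCoeff x = 0) (hx1 : PowerSeries.coeff 1 x = 1)
    (hG : ∀ j ∈ J, ∀ s, (G j s).map (Int.castRingHom ℚ) = PowerSeries.subst x (g j s))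
    (hF : (∑ j ∈ J, (a j : ℚ) • ∏ s, ((g j s).toMvPowerSeries s : MvPowerSeries σ ℚ)) ≠ 0) :
    ∃ n : σ →₀ ℕ, ∃ c : ℤ, c ≠ 0 ∧
      (n.degree : ℕ∞) =
        (∑ j ∈ J, (a j : ℚ) • ∏ s, ((g j s).toMvPowerSeries s : MvPowerSeries σ ℚ)).order ∧
      coeff n (∑ j ∈ J, (a j : ℚ) • ∏ s, ((g j s).toMvPowerSeries s : MvPowerSeries σ ℚ)) = c ∧
      ∀ e : σ →₀ ℕ, e.degree < n.degree →
        coeff e (∑ j ∈ J, (a j : ℚ) • ∏ s, ((g j s).toMvPowerSeries s : MvPowerSeries σ ℚ)) =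
          0 := by
  set F := ∑ j ∈ J, (a j : ℚ) • ∏ s, ((g j s).toMvPowerSeries s : MvPowerSeries σ ℚ) with hFdef
  obtain ⟨n, hn, hdeg⟩ := exists_coeff_ne_zero_and_order (ne_zero_iff_order_finite.mp hF)
  have hle : ((n.degree : ℕ) : ℕ∞) ≤ F.order := le_of_eq hdeg
  have hcoeff : coeff n F = ((∑ j ∈ J, a j * ∏ s, PowerSeries.coeff (n s) (G j s) : ℤ) : ℚ) := by
    have h := coeff_eq_map_of_degree_le_order (Int.castRingHom ℚ) J a g G hx0 hx1 hG
      (β := n.degree) (by simpa only [eq_intCast, hFdef] using hle) (e := n) rfl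
    simpa only [eq_intCast, hFdef] using h
  refine ⟨n, ∑ j ∈ J, a j * ∏ s, PowerSeries.coeff (n s) (G j s), ?_, hdeg, hcoeff, ?_⟩
  · intro h0
    apply hn
    rw [hcoeff, h0, Int.cast_zero]
  · intro e he
    apply coeff_of_lt_order
    rw [← hdeg]
    exact_mod_cast he

/-- **The Liouville lower bound `|c| ≥ 1`** (CDT §2.2, display (2.6)): in the situation of
`exists_coeff_eq_intCast_of_ne_zero`, some lowest-order coefficient of `F` has absolute value
`≥ 1`. [cite: CalegariDimitrovTang2025, §2.2, (2.6)] -/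
theorem one_le_abs_coeff_of_ne_zero {ι : Type*} (J : Finset ι) (a : ι → ℤ)
    (g : ι → σ → PowerSeries ℚ) (G : ι → σ → PowerSeries ℤ) {x : PowerSeries ℚ}
    (hx0 : PowerSeries.constantCoeff x = 0) (hx1 : PowerSeries.coeff 1 x = 1)
    (hG : ∀ j ∈ J, ∀ s, (G j s).map (Int.castRingHom ℚ) = PowerSeries.subst x (g j s))
    (hF : (∑ j ∈ J, (a j : ℚ) • ∏ s, ((g j s).toMvPowerSeries s : MvPowerSeries σ ℚ)) ≠ 0) :
    ∃ n : σ →₀ ℕ,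
      (n.degree : ℕ∞) =
        (∑ j ∈ J, (a j : ℚ) • ∏ s, ((g j s).toMvPowerSeries s : MvPowerSeries σ ℚ)).order ∧
      1 ≤ |coeff n (∑ j ∈ J, (a j : ℚ) • ∏ s, ((g j s).toMvPowerSeries s : MvPowerSeries σ ℚ))| := by
  obtain ⟨n, c, hc, hdeg, hcoeff, -⟩ := exists_coeff_eq_intCast_of_ne_zero J a g G hx0 hx1 hG hF
  refine ⟨n, hdeg, ?_⟩
  rw [hcoeff, ← Int.cast_abs, ← Int.cast_one, Int.cast_le]
  exact Int.one_le_abs hc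

end Literature.RingTheory.MvPowerSeries
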